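import Summits.HodgeConjecture.HodgeConjecture.Theorems.MarkmanPartnerTransportPicardThreeK3SquaresNikulinIsogeny
import Summits.HodgeConjecture.HodgeConjecture.Theorems.MarkmanPartnerTransportPicardThreeK3SquaresSymplecticLocus
import Literature.AlgebraicGeometry.Surfaces.GeometricGenusOneAssociatedK3Surface
import Literature.AlgebraicGeometry.Surfaces.K3NikulinInvolutionOfPrimitiveE8

/-!
# Route MarkmanPartnerTransport · crux `PicardThreeK3Squares` (stmt-HodgeConjecture-19652) —
# the Hodge conjecture for `S × S` for EVERY projective K3 surface of Picard rank `≥ 11` with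
# `End_Hdg(T(S)) ⊆ ℚ(√2) ∋ √2` (real multiplication by `ℚ(√2)` at `ρ ∈ {12, 14, 16}`), modulo named facts

The known real-multiplication sector of the crux contained Varesco's Thm. 2.1 (tree fact
`Varesco2023_sqrtMultiplication_algebraic_of_symplecticAutomorphism`; consumer
`SymplecticLocus.hodgeConjectureFor_square_of_isNikulinInvolution`, gen 0): HC⁴(S ⊗ S) for a projective K3
surface `S` WITH A NIKULIN INVOLUTION whose `End_Hdg(T(S))` lies in `ℚ + ℚψ`, `ψ` a Hodge similitude
of multiplier `2`. This file removes the involution from the hypotheses at Picard rank `≥ 11`: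

1. `…NikulinIsogeny`: every marked projective K3 surface `S` with `ρ(S) ≥ 11` is ISOGENOUS (rational
   marked Hodge isometry `σ`, `σ x' = x`) to a marked projective K3 surface `S'` whose Néron–Severi
   lattice contains, through the marking, the anti-invariant `E₈(−2)` of the model Nikulin involution
   (Kitaoka's codimension-`3` theorem + Witt + surjectivity of the period map);
2. the tree's NAMED FACT `Literature.AlgebraicGeometry.Surfaces.VanGeemenSarti2007_nikulinInvolution_of_primitiveE8`
   (`K3NikulinInvolutionOfPrimitiveE8.lean`: van Geemen–Sarti 2007 §2.1 and the proof of Prop. 2.3, via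
   Nikulin 1979 Thm. 4.3; quoted as an equivalence by Varesco 2023 §2: "a K3 surface `X` admits a Nikulin
   involution if and only if the lattice `E₈(−2)` is primitively embedded in the Néron–Severi group of
   `X`") gives a Nikulin involution on `S'`;
3. the real-multiplication data (`ψ`, the sector clause `End_Hdg ⊆ ℚ + ℚψ`) TRANSPORT along the
   isogeny to `S'` (`transport_sqrtTwo`), so gen 0's theorem gives HC⁴(S' ⊗ S');
4. isogeny invariance (`IsogenyInvariance.hodgeConjectureFor_square_of_markedIsometry`, mod Buskin)
   carries HC⁴ back to `S ⊗ S`.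

Main statement `hodgeConjectureFor_square_of_eleven_le_of_sqrtTwo`: **for every marked projective K3
surface `S` with `ρ(S) ≥ 11` and every Hodge similitude `ψ` of `T(S)` of multiplier `2` (`ψ² = 2`) with
`End_Hdg(T(S)) ⊆ ℚ + ℚψ`, `HodgeConjectureFor 4 (S ⊗ S)`** — modulo `Buskin2019_hodgeIsometry_algebraic`,
`Huybrechts_K3_periodSurjective_projective`, `Varesco2023_sqrtMultiplication_algebraic_of_symplecticAutomorphism`
and `VanGeemenSarti2007_nikulinInvolution_of_primitiveE8`. Since real multiplication at `22 − ρ ∈ {6, 8, 10}` is by a real QUADRATIC field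
(`RealMultiplicationRanks`: `22 − ρ = e·m`, `m ≥ 3`), this is HC⁴(S ⊗ S) for EVERY projective K3
surface of Picard rank `12, 14` or `16` with real multiplication by `ℚ(√2)` — the whole one-, two- and
three-dimensional RM Noether–Lefschetz loci, not only Varesco's four-dimensional families at `ρ = 10`
(where `T(X) ↪ U³_ℚ ⊕ E₈(−2)_ℚ` is a genuine condition). The marking-free form
`hodgeConjectureFor_square_of_eleven_le_of_sqrtTwo'` takes `Huybrechts_K3_marking_exists` in addition.

No definition, no sorry. Prover seat hodge-nonav-19652-p1 (gen 3), `--supports stmt-HodgeConjecture-19652`.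

References: B. van Geemen, A. Sarti, *Nikulin involutions on K3 surfaces*, Math. Z. 255 (2007), §2.1,
Prop. 2.2, Prop. 2.3 (proof); V. V. Nikulin, *Finite groups of automorphisms of Kählerian K3 surfaces*,
Trudy Moskov. Mat. Obshch. 38 (1979), Thm. 4.3; M. Varesco, Math. Z. 305 (2023), §2 (before Prop. 2.5),
Prop. 2.5, Thm. 2.1, Thm. 2.9; D. Huybrechts, *Lectures on K3 Surfaces*, Ch. 15 §4; N. Buskin, J. reine
angew. Math. 755 (2019), Thm. 1.1.
-/

set_option linter.dupNamespace false

noncomputable section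

namespace Summit.HodgeConjecture.HodgeConjecture.Theorems.MarkmanPartnerTransport.NikulinIsogeny

open scoped TensorProduct
open Module CategoryTheory MonoidalCategory
open Literature.AlgebraicGeometry Literature.AlgebraicGeometry.Motives Literature.AlgebraicGeometry.HodgeTheory
open Literature.AlgebraicGeometry.Surfaces
open Literature.AlgebraicTopology.SingularHomology
open Summit.HodgeConjecture.HodgeConjecture.Theorems
open Summit.HodgeConjecture.HodgeConjecture.Theorems.NikulinTwinTransport
open Summit.HodgeConjecture.HodgeConjecture.Theorems.MarkmanPartnerTransport.IsogenyInvariance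

variable {S S' : SchemeOver ℂ}

/-- `MarkedK3[S, η, p, x]`: VERBATIM the `let MarkedK3 := …` binder of the route declaration
`PicardThreeK3Squares`. Local notation only. -/
local notation3 (prettyPrint := false) "MarkedK3[" S ", " η ", " p ", " x "]" =>
  (p ≠ 0 ∧ (IsIntegralClass p ∧
    (∀ q : complexBetti S (2 * 2), IsIntegralClass q → ∃ n : ℤ, q = n • p) ∧
    (∀ c : complexBetti S (2 * 1), IsIntegralClass c ↔ ∃ v : K3Index → ℤ, η c = fun i => (v i : ℂ)) ∧
    (∀ a b : complexBetti S (2 * 1),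
      cupProduct (rfl : 2 * 1 + 2 * 1 = 2 * 2) a b = k3Form (η a) (η b) • p) ∧
    IsOfHodgeType 2 S (2 * 1) 2 0 (LinearEquiv.symm η x) ∧
    (∀ τ : complexBetti S (2 * 1), IsOfHodgeType 2 S (2 * 1) 2 0 τ →
      ∃ t : ℂ, τ = t • LinearEquiv.symm η x)) ∧
    (k3Form x x = 0 ∧ 0 < (k3Form (star x) x).re ∧
      ∃ u : K3Index → ℤ, k3Form (fun i => (u i : ℂ)) x = 0 ∧ 0 < ∑ i, ∑ j, u i * k3Gram i j * u j))

/-- `SqrtSector[S, ψ]`: the real-multiplication data of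
`SymplecticLocus.hodgeConjectureFor_square_of_isNikulinInvolution` for `p = 2` — `ψ` maps
`T(S) = transcendentalSubspace S` to itself, is rational and type-preserving there, `ψ² = 2` and `ψ` has
multiplier `2` on `T(S)`, and every rational Hodge endomorphism of `H²(S)` killing `N¹` with image
`⊥ N¹` is `a + bψ` on `T(S)`. Local notation only. -/
local notation3 (prettyPrint := false) "SqrtSector[" S ", " ψ "]" =>
  (Set.MapsTo ψ (transcendentalSubspace S) (transcendentalSubspace S) ∧
    (∀ x ∈ transcendentalSubspace S, IsRationalClass x → IsRationalClass (ψ x)) ∧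
    (∀ (i j : ℕ), ∀ x ∈ transcendentalSubspace S,
      IsOfHodgeType 2 S (2 * 1) i j x → IsOfHodgeType 2 S (2 * 1) i j (ψ x)) ∧
    (∀ x ∈ transcendentalSubspace S, ψ (ψ x) = (2 : ℂ) • x) ∧
    (∀ x ∈ transcendentalSubspace S, ∀ y ∈ transcendentalSubspace S,
      cupProduct (rfl : 2 * 1 + 2 * 1 = 2 * 2) (ψ x) (ψ y) =
        (2 : ℂ) • cupProduct (rfl : 2 * 1 + 2 * 1 = 2 * 2) x y) ∧
    (∀ (f : complexBetti S (2 * 1) →ₗ[ℂ] complexBetti S (2 * 1)),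
      (∀ y, IsRationalClass y → IsRationalClass (f y)) →
      (∀ (i j : ℕ) y, IsOfHodgeType 2 S (2 * 1) i j y → IsOfHodgeType 2 S (2 * 1) i j (f y)) →
      (∀ d ∈ algebraicClasses S 1, f d = 0) →
      (∀ y : complexBetti S (2 * 1), ∀ d ∈ algebraicClasses S 1,
        cupProduct (rfl : 2 * 1 + 2 * 1 = 2 * 2) (f y) d = 0) →
      ∃ a b : ℚ, ∀ y : complexBetti S (2 * 1),
        (∀ d ∈ algebraicClasses S 1, cupProduct (rfl : 2 * 1 + 2 * 1 = 2 * 2) y d = 0) →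
        f y = (a : ℂ) • y + (b : ℂ) • ψ y))

/-! ### Transport of the `√2`-sector data along a marked isogeny -/

/-- **The `√2`-sector data transport along a marked rational Hodge isometry.** For marked projective
K3 surfaces `(S, η, p, x)`, `(S', η', p', x')` and a rational isometry `σ` of `(Λ_ℂ, k3Form)` with
`σ x' = x`, the conjugate `ψ' = Ψ ∘ ψ ∘ Φ` (`Φ = η⁻¹ σ η'`, `Ψ = η'⁻¹ σ⁻¹ η`) of a Hodge similitude
`ψ` of multiplier `2` of `T(S)` with `End_Hdg(T(S)) ⊆ ℚ + ℚψ` is such a datum on `S'`: `Φ`, `Ψ`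
exchange `T(S')` and `T(S)` (they exchange `N¹` by Lefschetz `(1,1)` and preserve the lattice pairing
`(η · . η ·)`), preserve rationality and every Hodge type (`isRationalClass_markingConj`,
`isOfHodgeType_markingConj`), and conjugation preserves `ψ² = 2`, the multiplier and the sector clause.
[cite: Varesco2023, §0.2 and §2 (p. 8)] [cite: Buskin2019, §6.2] -/
theorem transport_sqrtTwo (hS : IsK3Surface S) (hS' : IsK3Surface S')
    (η : complexBetti S (2 * 1) ≃ₗ[ℂ] (K3Index → ℂ)) (p : complexBetti S (2 * 2)) (x : K3Index → ℂ)
    (η' : complexBetti S' (2 * 1) ≃ₗ[ℂ] (K3Index → ℂ)) (p' : complexBetti S' (2 * 2))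
    (x' : K3Index → ℂ) (hM : MarkedK3[S, η, p, x]) (hM' : MarkedK3[S', η', p', x'])
    (σ : Module.End ℂ (K3Index → ℂ)) (hσ : ∀ a b, k3Form (σ a) (σ b) = k3Form a b)
    (hσrat : ∀ v : K3Index → ℤ, ∃ w : K3Index → ℚ, σ (fun i => (v i : ℂ)) = fun i => (w i : ℂ))
    (hσx : σ x' = x) (ψ : complexBetti S (2 * 1) →ₗ[ℂ] complexBetti S (2 * 1))
    (hψ : SqrtSector[S, ψ]) :
    ∃ ψ' : complexBetti S' (2 * 1) →ₗ[ℂ] complexBetti S' (2 * 1), SqrtSector[S', ψ'] := by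
  have h4 : 2 * 1 + 2 * 1 = 2 * 2 := rfl
  have hHT : Huybrechts_K3_hodgeTypes_H2 := Huybrechts_K3_hodgeTypes_H2_holds
  obtain ⟨hp0, ⟨hpint, hpgen, hηint, hηcup, h20, -⟩, -, hxpos, -⟩ := hM
  obtain ⟨hp'0, ⟨hp'int, hp'gen, hη'int, hη'cup, h20', -⟩, -, hx'pos, -⟩ := hM'
  obtain ⟨hψT, hψrat, hψtyp, hψsq, hψmul, hU⟩ := hψ
  obtain ⟨σi, hσσi, hσiσ, hσi, hσirat⟩ := exists_inverse_ratIsometry σ hσ hσrat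
  have hσix : ∃ t : ℂ, σi x = t • x' := ⟨1, by rw [← hσx, hσiσ, one_smul]⟩
  have hσ1 : ∀ a b, k3Form (σ a) (σ b) = 1 * k3Form a b := fun a b ↦ by rw [hσ, one_mul]
  have hσi1 : ∀ a b, k3Form (σi a) (σi b) = 1 * k3Form a b := fun a b ↦ by rw [hσi, one_mul]
  -- the two maps
  set Φ : complexBetti S' (2 * 1) →ₗ[ℂ] complexBetti S (2 * 1) :=
    η.symm.toLinearMap ∘ₗ σ ∘ₗ η'.toLinearMap with hΦdef
  set Ψ : complexBetti S (2 * 1) →ₗ[ℂ] complexBetti S' (2 * 1) :=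
    η'.symm.toLinearMap ∘ₗ σi ∘ₗ η.toLinearMap with hΨdef
  have hΦapp : ∀ y, Φ y = η.symm (σ (η' y)) := fun y ↦ rfl
  have hΨapp : ∀ y, Ψ y = η'.symm (σi (η y)) := fun y ↦ rfl
  have hΦΨ : ∀ y, Φ (Ψ y) = y := fun y ↦ by
    rw [hΦapp, hΨapp, LinearEquiv.apply_symm_apply, hσσi, LinearEquiv.symm_apply_apply]
  have hΨΦ : ∀ y, Ψ (Φ y) = y := fun y ↦ by
    rw [hΨapp, hΦapp, LinearEquiv.apply_symm_apply, hσiσ, LinearEquiv.symm_apply_apply]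
  have hΦrat : ∀ y, IsRationalClass y → IsRationalClass (Φ y) := fun y hy ↦ by
    rw [hΦapp]; exact isRationalClass_markingConj η η' σ hS hS' hηint hη'int hσrat hy
  have hΨrat : ∀ y, IsRationalClass y → IsRationalClass (Ψ y) := fun y hy ↦ by
    rw [hΨapp]; exact isRationalClass_markingConj η' η σi hS' hS hη'int hηint hσirat hy
  have hΦtyp : ∀ (i j : ℕ) y, IsOfHodgeType 2 S' (2 * 1) i j y → IsOfHodgeType 2 S (2 * 1) i j (Φ y) :=
    fun i j y hy ↦ by
      rw [hΦapp]
      exact isOfHodgeType_markingConj η p x η' p' x' σ hHT hS hS' hηint hηcup h20 hxpos hη'int hη'cup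
        hp'0 h20' hx'pos hσrat one_ne_zero hσ1 ⟨1, by rw [hσx, one_smul]⟩ i j y hy
  have hΨtyp : ∀ (i j : ℕ) y, IsOfHodgeType 2 S (2 * 1) i j y → IsOfHodgeType 2 S' (2 * 1) i j (Ψ y) :=
    fun i j y hy ↦ by
      rw [hΨapp]
      exact isOfHodgeType_markingConj η' p' x' η p x σi hHT hS' hS hη'int hη'cup h20' hx'pos hηint hηcup
        hp0 h20 hxpos hσirat one_ne_zero hσi1 hσix i j y hy
  -- the lattice pairings `⟪a, b⟫ = (η a . η b)` and their transport
  have hΦpair : ∀ a b, k3Form (η (Φ a)) (η (Φ b)) = k3Form (η' a) (η' b) := fun a b ↦ by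
    rw [hΦapp, hΦapp, LinearEquiv.apply_symm_apply, LinearEquiv.apply_symm_apply, hσ]
  have hΨpair : ∀ a b, k3Form (η' (Ψ a)) (η' (Ψ b)) = k3Form (η a) (η b) := fun a b ↦ by
    rw [hΨapp, hΨapp, LinearEquiv.apply_symm_apply, LinearEquiv.apply_symm_apply, hσi]
  have hcup0 : ∀ a b : complexBetti S (2 * 1), cupProduct h4 a b = 0 ↔ k3Form (η a) (η b) = 0 := by
    intro a b
    rw [hηcup]
    refine ⟨fun h ↦ ?_, fun h ↦ by rw [h, zero_smul]⟩
    rcases smul_eq_zero.1 h with h | h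
    · exact h
    · exact absurd h hp0
  have hcup0' : ∀ a b : complexBetti S' (2 * 1), cupProduct h4 a b = 0 ↔ k3Form (η' a) (η' b) = 0 := by
    intro a b
    rw [hη'cup]
    refine ⟨fun h ↦ ?_, fun h ↦ by rw [h, zero_smul]⟩
    rcases smul_eq_zero.1 h with h | h
    · exact h
    · exact absurd h hp'0
  -- `N¹ ↦ N¹` and `T ↦ T`
  have hΦN : ∀ d ∈ algebraicClasses S' 1, Φ d ∈ algebraicClasses S 1 := fun d hd ↦
    SectorTransport.map_mem_algebraicClasses_one hS.1 hS'.1 Φ hΦrat (hΦtyp 1 1) hd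
  have hΨN : ∀ d ∈ algebraicClasses S 1, Ψ d ∈ algebraicClasses S' 1 := fun d hd ↦
    SectorTransport.map_mem_algebraicClasses_one hS'.1 hS.1 Ψ hΨrat (hΨtyp 1 1) hd
  have hTiff : ∀ y, y ∈ transcendentalSubspace S ↔ ∀ d ∈ algebraicClasses S 1, cupProduct h4 y d = 0 :=
    fun y ↦ mem_transcendentalSubspace_iff_forall_algebraicClasses hS.1 y
  have hTiff' : ∀ y, y ∈ transcendentalSubspace S' ↔
      ∀ d ∈ algebraicClasses S' 1, cupProduct h4 y d = 0 :=
    fun y ↦ mem_transcendentalSubspace_iff_forall_algebraicClasses hS'.1 y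
  have hΦT : ∀ y ∈ transcendentalSubspace S', Φ y ∈ transcendentalSubspace S := by
    intro y hy
    rw [hTiff]
    intro d hd
    rw [← hΦΨ d, hcup0, hΦpair, ← hcup0']
    exact (hTiff' y).1 hy _ (hΨN d hd)
  have hΨT : ∀ y ∈ transcendentalSubspace S, Ψ y ∈ transcendentalSubspace S' := by
    intro y hy
    rw [hTiff']
    intro d hd
    rw [← hΨΦ d, hcup0', hΨpair, ← hcup0]
    exact (hTiff y).1 hy _ (hΦN d hd)
  -- the multiplier clause through the pairing
  have hψpair : ∀ u ∈ transcendentalSubspace S, ∀ v ∈ transcendentalSubspace S,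
      k3Form (η (ψ u)) (η (ψ v)) = 2 * k3Form (η u) (η v) := by
    intro u hu v hv
    have h := hψmul u hu v hv
    rw [hηcup, hηcup, smul_smul] at h
    have h1 := sub_eq_zero.2 h
    rw [← sub_smul, smul_eq_zero, sub_eq_zero] at h1
    rcases h1 with h1 | h1
    · exact h1
    · exact absurd h1 hp0
  have hψ'app : ∀ y, (Ψ ∘ₗ ψ ∘ₗ Φ) y = Ψ (ψ (Φ y)) := fun y ↦ rfl
  refine ⟨Ψ ∘ₗ ψ ∘ₗ Φ, fun y hy ↦ ?_, fun y hy hyQ ↦ ?_, fun i j y hy hyt ↦ ?_, fun y hy ↦ ?_,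
    fun u hu v hv ↦ ?_, fun f hfrat hftyp hfN hfT ↦ ?_⟩
  · -- `T ↦ T`
    rw [hψ'app]
    exact hΨT _ (hψT (hΦT y hy))
  · -- rational on `T`
    rw [hψ'app]
    exact hΨrat _ (hψrat _ (hΦT y hy) (hΦrat y hyQ))
  · -- Hodge types on `T`
    rw [hψ'app]
    exact hΨtyp i j _ (hψtyp i j _ (hΦT y hy) (hΦtyp i j y hyt))
  · -- `ψ'² = 2`
    rw [hψ'app, hψ'app, hΦΨ, hψsq _ (hΦT y hy), map_smul, hΨΦ]
  · -- multiplier `2`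
    rw [hψ'app, hψ'app, hη'cup, hη'cup, hΨpair, hψpair _ (hΦT u hu) _ (hΦT v hv), hΦpair, smul_smul]
  · -- the sector clause
    have hfapp : ∀ y, (Φ ∘ₗ f ∘ₗ Ψ) y = Φ (f (Ψ y)) := fun y ↦ rfl
    obtain ⟨a, b, hab⟩ := hU (Φ ∘ₗ f ∘ₗ Ψ)
      (fun y hy ↦ hΦrat _ (hfrat _ (hΨrat _ hy)))
      (fun i j y hy ↦ hΦtyp i j _ (hftyp i j _ (hΨtyp i j y hy)))
      (fun d hd ↦ by rw [hfapp, hfN _ (hΨN d hd), map_zero])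
      (fun y d hd ↦ by
        rw [hfapp, ← hΦΨ d, hcup0, hΦpair, ← hcup0']
        exact hfT _ _ (hΨN d hd))
    refine ⟨a, b, fun y hy ↦ ?_⟩
    have hyT : ∀ d ∈ algebraicClasses S 1, cupProduct h4 (Φ y) d = 0 := fun d hd ↦ by
      rw [← hΦΨ d, hcup0, hΦpair, ← hcup0']
      exact hy _ (hΨN d hd)
    have h := hab (Φ y) hyT
    rw [hfapp, hΨΦ] at h
    -- apply `Ψ`
    have h2 := congrArg Ψ h
    rw [hΨΦ, map_add, map_smul, map_smul, hΨΦ] at h2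
    rw [h2, hψ'app]

/-! ### The Hodge conjecture for `S × S`, `ρ(S) ≥ 11`, `End_Hdg(T(S)) ⊆ ℚ(√2) ∋ √2` -/

/-- **HC⁴(S ⊗ S) for every marked projective K3 surface with `ρ(S) ≥ 11` whose rational Hodge
endomorphisms of `T(S)` lie in `ℚ + ℚψ` for a Hodge similitude `ψ` of multiplier `2`** (e.g. every
projective K3 surface of Picard rank `12, 14, 16` with real multiplication by `ℚ(√2)`), modulo the
named facts `Buskin2019_hodgeIsometry_algebraic`, `Huybrechts_K3_periodSurjective_projective`,
`Varesco2023_sqrtMultiplication_algebraic_of_symplecticAutomorphism` and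
`VanGeemenSarti2007_nikulinInvolution_of_primitiveE8`. Proof: the isogenous marked `S'` of
`exists_isogenous_antiInvariant_algebraic` carries the anti-invariant `E₈(−2)` (Gram `−2E₈`,
`toBilin'_k3Gram_nikulinAntiInvariantParam`; primitive) inside `NS(S')`, hence a Nikulin involution;
`transport_sqrtTwo` moves `ψ` and the sector clause to `S'`; gen 0's
`SymplecticLocus.hodgeConjectureFor_square_of_isNikulinInvolution` gives HC⁴(S' ⊗ S'); isogeny
invariance brings it back. [cite: Varesco2023, Thm. 2.1, Prop. 2.5 and Thm. 2.9]
[cite: VanGeemenSarti2007, §2.1 and Prop. 2.3] [cite: Kitaoka1993, Ch. 4 Cor. 4.1.4]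
[cite: Buskin2019, Thm. 1.1] -/
theorem hodgeConjectureFor_square_of_eleven_le_of_sqrtTwo (hB : Buskin2019_hodgeIsometry_algebraic)
    (hPS : Huybrechts_K3_periodSurjective_projective)
    (hV : Varesco2023_sqrtMultiplication_algebraic_of_symplecticAutomorphism)
    (hGS : VanGeemenSarti2007_nikulinInvolution_of_primitiveE8)
    (hS : IsK3Surface S)
    (η : complexBetti S (2 * 1) ≃ₗ[ℂ] (K3Index → ℂ)) (p : complexBetti S (2 * 2)) (x : K3Index → ℂ)
    (hM : MarkedK3[S, η, p, x]) (hρ : 11 ≤ Module.finrank ℂ ↥(algebraicClasses S 1))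
    (ψ : complexBetti S (2 * 1) →ₗ[ℂ] complexBetti S (2 * 1)) (hψ : SqrtSector[S, ψ]) :
    HodgeConjectureFor 4 (S ⊗ S) := by
  classical
  obtain ⟨S', hS', η', p', x', σ, hM', hσ, hσrat, hσx, hK⟩ :=
    exists_isogenous_antiInvariant_algebraic hPS hS η p x hM hρ
  -- the Nikulin involution on `S'`
  obtain ⟨hp'0, ⟨hp'int, hp'gen, hη'int, hη'cup, h20', -⟩, -, hx'pos, -⟩ := id hM'
  let v : Fin 8 → (K3Index → ℤ) := fun i => nikulinAntiInvariantParam (Pi.single i 1)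
  have hvGram : ∀ i j : Fin 8, ∑ a, ∑ b, v i a * k3Gram a b * v j b = -2 * CartanMatrix.E₈ i j := by
    intro i j
    have h := toBilin'_k3Gram_nikulinAntiInvariantParam (Pi.single i 1) (Pi.single j 1)
    rw [Matrix.toBilin'_apply, LinearMap.BilinForm.smul_apply_apply, Literature.Topology.FourManifolds.e8Form,
      Matrix.toBilin'_single] at h
    exact h
  have hvcoord : ∀ i a, v i (Sum.inl (Sum.inl a)) = if a = i then 1 else 0 := by
    intro i a
    change (Sum.elim (Sum.elim (Pi.single i (1 : ℤ)) (-Pi.single i (1 : ℤ))) 0 : K3Index → ℤ)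
      (Sum.inl (Sum.inl a)) = _
    rw [Sum.elim_inl, Sum.elim_inl, Pi.single_apply]
  have hvprim : ∀ c : Fin 8 → ℚ, (∃ w : K3Index → ℤ, ∀ a, (w a : ℚ) = ∑ i, c i * (v i a : ℚ)) →
      ∀ i, ∃ n : ℤ, c i = n := by
    rintro c ⟨w, hw⟩ i
    refine ⟨w (Sum.inl (Sum.inl i)), ?_⟩
    rw [hw]
    simp only [hvcoord, Int.cast_ite, Int.cast_one, Int.cast_zero, mul_ite, mul_one, mul_zero]
    rw [Finset.sum_ite_eq, if_pos (Finset.mem_univ i)]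
  have hvalg : ∀ i, η'.symm (fun a => (v i a : ℂ)) ∈ algebraicClasses S' 1 :=
    fun i ↦ hK _ (nikulinAntiInvariantParam_mem _)
  obtain ⟨ι', hι'⟩ := hGS S' hS' η' p' hη'int hη'cup v hvGram hvprim hvalg
  -- transport the `√2`-data and apply the `σ_p`-locus theorem on `S'`
  obtain ⟨ψ', hψ'T, hψ'rat, hψ'typ, hψ'sq, hψ'mul, hU'⟩ :=
    transport_sqrtTwo hS hS' η p x η' p' x' hM hM' σ hσ hσrat hσx ψ hψ
  have hHC' : HodgeConjectureFor 4 (S' ⊗ S') :=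
    SymplecticLocus.hodgeConjectureFor_square_of_isNikulinInvolution hV hS' hι' ψ' hψ'T hψ'rat hψ'typ
      hψ'sq hψ'mul hU'
  -- back to `S` along the isogeny
  obtain ⟨hp0, ⟨hpint, hpgen, hηint, hηcup, h20, -⟩, -, hxpos, -⟩ := hM
  exact hodgeConjectureFor_square_of_markedIsometry hB hS hS' η p x η' p' x' ⟨hpint, hpgen⟩ hηint hηcup
    h20 hxpos ⟨hp'int, hp'gen⟩ hη'int hη'cup h20' hx'pos σ hσ hσrat ⟨1, by rw [hσx, one_smul]⟩ hHC'

/-- **Marking-free form.** For every projective K3 surface `S` with `ρ(S) ≥ 11` carrying a Hodge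
similitude `ψ` of `T(S)` of multiplier `2` with `End_Hdg(T(S)) ⊆ ℚ + ℚψ` — in particular EVERY
projective K3 surface of Picard rank `12`, `14` or `16` with real multiplication by `ℚ(√2)` — the Hodge
conjecture holds for `S ⊗ S`, modulo the named facts `Buskin2019_hodgeIsometry_algebraic`,
`Huybrechts_K3_marking_exists`, `Huybrechts_K3_periodSurjective_projective`,
`Varesco2023_sqrtMultiplication_algebraic_of_symplecticAutomorphism`,
`VanGeemenSarti2007_nikulinInvolution_of_primitiveE8`. The σ₂-locus of gen 0 (K3 surfaces WITH a
Nikulin involution) is replaced by its whole isogeny saturation, which at rank `rk T(S) ≤ 11` is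
everything (Kitaoka). [cite: Varesco2023, Thm. 2.1, Prop. 2.5, Thm. 2.9 and Rem. 2.10]
[cite: VanGeemenSarti2007, Prop. 2.3] [cite: Kitaoka1993, Ch. 4 Cor. 4.1.4] -/
theorem hodgeConjectureFor_square_of_eleven_le_of_sqrtTwo' (hB : Buskin2019_hodgeIsometry_algebraic)
    (hmark : Huybrechts_K3_marking_exists) (hPS : Huybrechts_K3_periodSurjective_projective)
    (hV : Varesco2023_sqrtMultiplication_algebraic_of_symplecticAutomorphism)
    (hGS : VanGeemenSarti2007_nikulinInvolution_of_primitiveE8)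
    (hS : IsK3Surface S) (hρ : 11 ≤ Module.finrank ℂ ↥(algebraicClasses S 1))
    (ψ : complexBetti S (2 * 1) →ₗ[ℂ] complexBetti S (2 * 1)) (hψ : SqrtSector[S, ψ]) :
    HodgeConjectureFor 4 (S ⊗ S) := by
  obtain ⟨η, p, x, hM⟩ := hmark S hS
  exact hodgeConjectureFor_square_of_eleven_le_of_sqrtTwo hB hPS hV hGS hS η p x hM hρ ψ hψ

end Summit.HodgeConjecture.HodgeConjecture.Theorems.MarkmanPartnerTransport.NikulinIsogeny

end
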